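import Summits.CriticalPhenomena.SAWScalingLimit.Theses.SAWExcursionCardy
import Summits.CriticalPhenomena.SAWScalingLimit.Theorems.SAWRenewalTightnessEventualTightSketchDefs

/-!
# Birth skeleton — crux `EventualTight` (stmt-CriticalPhenomena-1881), route `SAWExcursionCardy`

Crux (FIXED, concluded BY NAME by `EventualTight_of`; rank 6 of
`route-CriticalPhenomena-SAWExcursionCardy`, the precompactness half of its Prokhorov assembly;
the same decl body is the `EventualTight` of fourteen sibling routes, deduplicated by the ledger as
stmt-CriticalPhenomena-1881):

  `∀ D a b, SAW.IsEndpointApprox D a b →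
      IsTightAlongMesh (fun δ γ ↦ γ.curve) (fun δ ↦ SAW.law D.carrier δ (a δ) (b δ))`

— eventual tightness, on `CurveClass ℂ`, of the critical square-lattice SAW laws along `δ → 0⁺`.

## The cut (three registered stubs): VIRGIN-DISC CONDITIONING on interior shells + boundary shells

The standing analysis of this crux (`Cruxes/EventualTight/LeadAnalysis-c1.md` §2(c), §5;
`LeadAnalysis-c2.md` §5–6; hex twin `Cruxes/HexTight/STRATEGY-CENSUS.md`) leaves exactly one
architecture whose atoms survive both the corridor obstruction (sup-over-past / Condition-G2
statements are false as typed for floating starts and crux-sized when re-typed) and the connector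
deficit (fixed-resolution surgery): condition on the walk OUTSIDE a lattice disc containing an
interior shell; the middle piece is an `x_c`-weighted self-avoiding ARC between two doors of a disc
whose inside is VIRGIN (two-sided domain Markov property of `P ∝ x_c^{#edges}`, an identity of
finite sums).  Typed socket: `Cruxes/EventualTight/X2VirginDiscZ2.lean` (lead c1).  This skeleton
registers that architecture for the along-the-mesh twin stmt-1881, with two corrections to X2's
typing: (i) the interior/boundary dichotomy is the SCALE-INVARIANT one, `closedBall x R ⊆ Ω` or
not (X2's absolute collar `closedBall x (2R+1)` makes every shell of a small domain a "boundary"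
shell, so that its `BoundaryAtom` re-implies the whole crux by the mesh rescaling
`(Ω, δ) ↦ (λΩ, λδ)` — a costume); consequently the virgin-disc statement carries TWO aspects
`1 < B < A` (shell `D(z₀; N/A, N/B)` inside the virgin `N`-disc) instead of `B = 2`; (ii) the
resolution is existential (`∀ θ ∃ η`), exactly the quantifier shape of the tree atom
`CleanMultiShadowDecay` it feeds — X2 asked it for every `η`, which for `η ≥ 1` is plain
multi-traversal decay, a needlessly stronger bet.

* `stub_virginDiscShadowDecay` — **VIRGIN-DISC CLEAN-SHADOWING DECAY** (the atom; mesh-free,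
  rate-free, numerically testable; NOT implied by the crux — it is uniform over ARBITRARY
  exteriors): for all aspects `1 < B < A` and `θ > 0` there are a resolution `η > 0`, a strand
  number `j` and a radius `N₀` such that for every configuration `(H, Λ)` virgin in the lattice
  disc `B(z₀, N)`, `N ≥ N₀`, and every pair of doors on its rim, the `x_c`-mass of door-to-door
  arcs whose polyline carries `j` CLEAN, CO-ORIENTED, pairwise `ηN`-shadowing separate traversal
  strands of `D(z₀; N/A, N/B)` is at most `θ ·` (arc mass).  This is where a two-pinned tool for
  the critical `ℤ²` SAW plugs in (LeadAnalysis-c2 §6); hex cousins `PinchDecay`/`ArcTraversalTight`.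
* `stub_virginization` — **EXACT GLUE** `VirginDiscShadowDecay → InteriorCleanShadowDecay` (true;
  L–XL bookkeeping, the `ℤ²` port of `Literature/…/HexSAWVirginization{Cut,Chordal,Rooted}` +
  `Theorems/…HexTightVirginization`): for an interior shell (`closedBall x R ⊆ Ω`, hence
  `closedBall x (R + 3ε) ⊆ Ω` for some `ε > 0`) take virgin mesh-radius `R + ε`
  (`N := (R+ε)/δ`, `B := (R+ε)/R`, `A := (R+ε)/r`); for `δ ≤ ε` small the endpoints `a_δ, b_δ`
  lie outside `closedBall x (R+2ε)` (endpoint limits of `IsEndpointApprox`, `a, b ∈ ∂Ω` — Disproof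
  §2 is honoured HERE) and the lattice points of `closedBall x (R+2ε)` form ONE `meshGraph`-component
  (a disc), so either all of them lie in the largest component `meshDomain Ω δ` (then
  `discreteDomainGraph Ω δ` is virgin at `(x/δ, N)`) or none does (then no SAW of `Ω_δ` meets
  `closedBall x R`: the event is empty); cut each SAW at its first entrance into / last exit from the
  closed lattice `N`-disc; conditionally on prefix and suffix the middle piece is `x_c`-distributed on
  `Arc H Λ c c'`; the clean strands of the shell live in the middle piece, and
  `HasCleanShadowingFamily` is covariant under `z ↦ δz` and under restriction to the middle piece's
  parameter window; sum the atom's inequality over (prefix, suffix).  Never uses the Jordan loop.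
* `stub_boundaryCleanShadowDecay` — **BOUNDARY SHELLS** (research atom, implied by the crux; the
  verbatim restriction of the tree atom `CleanMultiShadowDecay` to shells whose closed outer disc
  meets `Ωᶜ`): this is the ONLY place where the Jordan boundary loop of `D` can and must enter
  (Disproof §5 `eventualTight_false_without_jordan`: the dyadic snake forces unboundedly many
  traversals of ONE boundary shell `D((1/2,0); 3/5, 7/10)` — a boundary shell in the present
  dichotomy — so the stub is false over non-Jordan carriers, as it must be), together with the
  endpoint limits (shells at the marked points).

## Composition (PROVED here, no `sorry`): `EventualTight_of`

interior shells from the atom through the glue, boundary shells from the boundary stub (case split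
on `closedBall x R ⊆ Ω`) ⇒ the tree atom `CleanMultiShadowDecay` ⇒ (landed
`Theorems.EventualTight.Sketch.cleanMultiShadowDecay_iff_eventualTight`: generalised hyperspace
pigeonhole + coarse-mesh cutoff + Aizenman–Burchard, all kernel-checked) the set-form twin
`SAWRenewalTightness.EventualTight` (stmt-1372: `∃ δ₀ > 0`, `IsTightMeasureSet` of the push-forward
laws over `δ ∈ (0, δ₀]`) ⇒ (`isTightAlongMesh_of_isTightMeasureSet_image`, laws a.e.-measurable on
the discrete σ-algebra) the crux `SAWExcursionCardy.EventualTight`, BY NAME.  Every other route copy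
of stmt-1881 has the same body and follows by the same term.

## Calibration against `Cruxes/EventualTight/Disproof.lean` (cdisprove gen 1) and `Theorems/EventualTight/Negative/*`

* §2 `eventualTight_false_without_endpointLimits`: HONOURED — the endpoint limits are spent in
  `stub_virginization` (endpoints eventually outside the virgin disc) and are available to
  `stub_boundaryCleanShadowDecay` (both keep `IsEndpointApprox` as a hypothesis).
* §3 `not_cruxAllMeshes` (= stmt-0772) / `not_uniformThreshold` / `not_uniformDomains`: every
  threshold here (`η, j, δ₁`; `N₀`) sits under `∀ (D, a, b) ∀ shell ∀ θ`; all mesh quantifiers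
  are eventual (`Ioc 0 δ₁`); nothing is uniform in the domain or the approximation.
* §5 `eventualTight_false_without_jordan` / `tightAlongMesh_false_without_jordan`: HONOURED — see
  `stub_boundaryCleanShadowDecay`; the atom and the glue are carrier-agnostic.
* §4 / `Negative/TightnessNecessary`: the crux is necessary for the summit conjunct, so the boundary
  stub (crux-implied) cannot be false unless `SAWScalingLimit` is; the atom `VirginDiscShadowDecay`
  is NOT crux-implied (sup over exteriors) — its cheapest falsifier is a forcing exterior acting
  through the two doors (hex one-arm analogue survived: `Cruxes/HexTight/DrefuteSurvived.md`), and
  the c1 numerics (`Numerics-c1.md`: X2 proxy flat in `N ≤ 32`, geometric decay in `k`) point the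
  right way.  No landed `Negative/*` lemma has an instance among the three stubs.
* Negatives index (`ledger negatives --problem CriticalPhenomena`): only stmt-0772 concerns
  tightness; avoided by the eventual quantifiers.

## Audit record (planner skeleton-register, 2026-08-17)

* `lean check --json`: rc 0, errors [], `sorries = 3` = the three `stub_*` (no other `sorry`);
  `#print axioms EventualTight_of` = `[propext, Classical.choice, Quot.sound]`.
* `#h21_check_skeleton "stmt-CriticalPhenomena-1881" …SAWExcursionCardy.EventualTight stub_…` and
  `ledger skeleton check --crux stmt-CriticalPhenomena-1881`: `ok = true`, `codes = []`, theorem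
  `EventualTight_of`, stubs registered `stub_virginDiscShadowDecay`, `stub_virginization`,
  `stub_boundaryCleanShadowDecay` (each resolved to the sorried theorem, signatures
  `VirginDiscShadowDecay` / `Virginization` / `BoundaryCleanShadowDecay`).
* BC3 probes (folder `bc/dprobe_*.lean`: environment = the definitions of this file only — no sorried
  stub, no composition in scope; battery `first | exact? | simpa | simpa [S] | (unfold S; simpa) | aesop`,
  a superset of `first | exact? | simpa | aesop`; each pair plain AND with the hypothesis introduced):
  `VirginDiscShadowDecay → EventualTight` FAIL ×2, `VirginDiscShadowDecay → SAWScalingLimit` FAIL ×2,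
  `Virginization → EventualTight` FAIL ×2, `Virginization → SAWScalingLimit` FAIL ×2,
  `BoundaryCleanShadowDecay → EventualTight` FAIL ×2, `BoundaryCleanShadowDecay → SAWScalingLimit`
  FAIL ×2 (all "unsolved goals" after exhaustive `aesop`; `exact?`/`simpa` find nothing); the same
  twelve probes with the sorried stubs in scope (`bc/sprobe_*.lean`) FAIL ×12 too.  Converse probes
  (crux → stub, Statement → stub; recorded, not required) FAIL ×6 mechanically — although the crux
  does imply `BoundaryCleanShadowDecay` through the landed chain (consequence used toward the crux).
  No stub is cheaply the crux or the summit.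

Namespace `…Cruxes.EventualTight.Birth`; objects `IsVirgin`, `IsDoor`, `Arc`, `arcCurve`,
`arcMass`, `cleanShadowMass` are those of `X2VirginDiscZ2.lean` VERBATIM (copied, not imported, so
that this certificate does not move when that proposal file is edited); `HasCleanShadowingFamily`,
`CleanMultiShadowDecay` are the TREE's (`Theorems/SAWRenewalTightnessEventualTightSketchDefs.lean`).
-/

noncomputable section

open MeasureTheory Filter Topology Set Metric
open scoped ENNReal NNReal unitInterval
open Literature.Probability.RandomPlanarGeometry Literature.Probability.LatticeModels
open Summit.CriticalPhenomena.SAWScalingLimit.Theorems.EventualTight.Sketch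
  (HasCleanShadowingFamily CleanMultiShadowDecay cleanMultiShadowDecay_iff_eventualTight)

namespace Summit.CriticalPhenomena.SAWScalingLimit.Cruxes.EventualTight.Birth

/-! ### Objects (lattice units; verbatim from `X2VirginDiscZ2.lean`) -/

/-- **Virgin configuration** at `(z₀, N)` (lattice units): `H` is a subgraph of `ℤ²`, every lattice
point of the open `N`-disc about `z₀` is allowed, and every lattice edge between points of the
closed `(N+1)`-disc is an edge of `H`.  Nothing is assumed outside the disc. -/
structure IsVirgin (H : SimpleGraph (Site 2)) (Λ : Finset (Site 2)) (z₀ : ℂ) (N : ℝ) : Prop where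
  /-- `H` is a subgraph of the nearest-neighbour graph of `ℤ²` -/
  le : H ≤ zdGraph 2
  /-- every lattice point of the open `N`-disc is allowed -/
  mem : ∀ v : Site 2, dist (Site.toComplex v) z₀ < N → v ∈ Λ
  /-- every lattice edge of the closed `(N+1)`-disc is an `H`-edge -/
  adj : ∀ v v' : Site 2, dist (Site.toComplex v) z₀ ≤ N + 1 → dist (Site.toComplex v') z₀ ≤ N + 1 →
    (zdGraph 2).Adj v v' → H.Adj v v'

/-- **Door** on the circle of radius `N`: a lattice edge from `u ∉ Λ` strictly outside the circle
to `c ∈ Λ` in the closed disc (the first-entrance / last-exit edge of the cut). -/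
def IsDoor (Λ : Finset (Site 2)) (z₀ : ℂ) (N : ℝ) (u c : Site 2) : Prop :=
  (zdGraph 2).Adj u c ∧ u ∉ Λ ∧ c ∈ Λ ∧ dist (Site.toComplex c) z₀ ≤ N ∧ N < dist (Site.toComplex u) z₀

/-- **Arcs**: self-avoiding `H`-walks from `c` to `c'` all of whose vertices are allowed (a finite
type when `Λ` is finite and `H ≤ zdGraph 2`; the masses below are `tsum`s, equal to the finite
sums). -/
def Arc (H : SimpleGraph (Site 2)) (Λ : Finset (Site 2)) (c c' : Site 2) : Type :=
  {p : H.Walk c c' // p.IsPath ∧ ∀ v ∈ p.support, v ∈ Λ}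

/-- The polyline of a walk, in lattice units. -/
def arcCurve {H : SimpleGraph (Site 2)} {c c' : Site 2} (p : H.Walk c c') : Curve ℂ :=
  ⟨p.toCurve Site.toComplex⟩

/-- `x_c`-mass of the arcs `c → c'`. -/
def arcMass (H : SimpleGraph (Site 2)) (Λ : Finset (Site 2)) (c c' : Site 2) : ℝ :=
  ∑' p : Arc H Λ c c', SAW.criticalFugacity ^ p.1.length

open Classical in
/-- `x_c`-mass of the arcs `c → c'` whose polyline has `j` CLEAN, CO-ORIENTED, pairwise
`η`-shadowing separate traversal strands of the shell `D(z₀; n, R)` (the tree's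
`HasCleanShadowingFamily`, lattice units). -/
def cleanShadowMass (H : SimpleGraph (Site 2)) (Λ : Finset (Site 2)) (c c' : Site 2) (j : ℕ) (z₀ : ℂ)
    (n R η : ℝ) : ℝ :=
  ∑' p : Arc H Λ c c',
    if HasCleanShadowingFamily (arcCurve p.1) j z₀ n R η then SAW.criticalFugacity ^ p.1.length else 0

/-! ### Stub statements -/

/-- **STUB 1 statement — `VirginDiscShadowDecay`** (the atom): for all aspects `1 < B < A` and
every `θ > 0` there are ONE resolution `η > 0`, a strand number `j` and a radius `N₀` such that,
uniformly over configurations virgin in a lattice disc of radius `N ≥ N₀` (ARBITRARY exterior) and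
over pairs of doors, the arcs carrying `j` clean co-oriented pairwise `ηN`-shadowing separate
traversal strands of `D(z₀; N/A, N/B)` have `x_c`-mass at most `θ ·` (arc mass). -/
def VirginDiscShadowDecay : Prop :=
  ∀ A B : ℝ, 1 < B → B < A → ∀ θ : ℝ, 0 < θ →
    ∃ η : ℝ, 0 < η ∧ ∃ (j : ℕ) (N₀ : ℝ), 0 < N₀ ∧
      ∀ (H : SimpleGraph (Site 2)) (Λ : Finset (Site 2)) (z₀ : ℂ) (N : ℝ) (u c u' c' : Site 2),
        N₀ ≤ N → IsVirgin H Λ z₀ N → IsDoor Λ z₀ N u c → IsDoor Λ z₀ N u' c' →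
        cleanShadowMass H Λ c c' j z₀ (N / A) (N / B) (η * N) ≤ θ * arcMass H Λ c c'

/-- The tree atom `CleanMultiShadowDecay` restricted to the shells selected by `good D x R`. -/
def CleanMultiShadowDecayOn (good : DobrushinDomain → ℂ → ℝ → Prop) : Prop :=
  ∀ (D : DobrushinDomain) (a b : ℝ → Site 2), SAW.IsEndpointApprox D a b →
    ∀ (x : ℂ) (r R : ℝ), 0 < r → r < R → good D x R → ∀ θ : ℝ, 0 < θ →
      ∃ η : ℝ, 0 < η ∧ ∃ (j : ℕ) (δ₁ : ℝ), 0 < δ₁ ∧ ∀ δ ∈ Set.Ioc (0 : ℝ) δ₁,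
        SAW.law D.carrier δ (a δ) (b δ)
          {γ | HasCleanShadowingFamily (⟨γ.walk.toCurve (meshPoint δ)⟩ : Curve ℂ) j x r R η}
          ≤ ENNReal.ofReal θ

/-- **Interior shells**: the closed outer disc lies in the (open) domain — scale-invariant. -/
def InteriorCleanShadowDecay : Prop :=
  CleanMultiShadowDecayOn fun D x R => Metric.closedBall x R ⊆ D.carrier

/-- **STUB 3 statement — boundary shells**: the closed outer disc meets `Ωᶜ`. -/
def BoundaryCleanShadowDecay : Prop :=
  CleanMultiShadowDecayOn fun D x R => ¬ Metric.closedBall x R ⊆ D.carrier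

/-- **STUB 2 statement — `Virginization`**: the exact glue from the virgin-disc atom to the tree
atom on interior shells (first-entrance / last-exit cutting, two-sided domain Markov identity,
similarity covariance; see the module docstring for the proof plan). -/
def Virginization : Prop := VirginDiscShadowDecay → InteriorCleanShadowDecay

/-! ### The registered stubs (the ONLY `sorry`s of the file) -/

/-- STUB 1 (the atom; open, crux-level content, NOT implied by the crux): virgin-disc
clean-shadowing decay for the critical `ℤ²` SAW, uniform in the exterior. -/
theorem stub_virginDiscShadowDecay : VirginDiscShadowDecay := by
  sorry

/-- STUB 2 (true; L–XL exact bookkeeping): virginization glue. -/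
theorem stub_virginization : Virginization := by
  sorry

/-- STUB 3 (open; crux-implied; where the Jordan loop and the endpoint limits must be used):
clean-shadowing decay on boundary shells. -/
theorem stub_boundaryCleanShadowDecay : BoundaryCleanShadowDecay := by
  sorry

/-! ### Name-keyed aliases — the hypotheses of `EventualTight_of`

The native skeleton audit (`#h21_check_skeleton`) admits a hypothesis of the skeleton theorem only if its
head constant is a registered obligation or is NAMED like a declared stub; `__Registered.stub_X` is the
statement of `stub_X` under that name (device of `Cruxes/AxiomsOfLimit/Lines/birth.lean`: the `__`
namespace is an implementation detail, so the audit's stub report resolves each `stub_…` to the sorried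
theorem, not to the alias; the gate-reserved `@[stub]` attribute is not written by a planner).  Each alias
is `rfl`-equal to its statement. -/
namespace __Registered

/-- Alias of `VirginDiscShadowDecay` keyed by the registered stub name. -/
abbrev stub_virginDiscShadowDecay : Prop := VirginDiscShadowDecay
/-- Alias of `Virginization` keyed by the registered stub name. -/
abbrev stub_virginization : Prop := Virginization
/-- Alias of `BoundaryCleanShadowDecay` keyed by the registered stub name. -/
abbrev stub_boundaryCleanShadowDecay : Prop := BoundaryCleanShadowDecay

end __Registered

/-! ### Composition (PROVED): stubs ⇒ the crux, by name -/

/-- Interior and boundary shells together give the tree atom back (case split on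
`closedBall x R ⊆ Ω`). [folklore] -/
theorem cleanMultiShadowDecay_of_interior_of_boundary (hI : InteriorCleanShadowDecay)
    (hB : BoundaryCleanShadowDecay) : CleanMultiShadowDecay := by
  intro D a b hab x r R hr hrR θ hθ
  by_cases h : Metric.closedBall x R ⊆ D.carrier
  · exact hI D a b hab x r R hr hrR h θ hθ
  · exact hB D a b hab x r R hr hrR h θ hθ

/-- **The composition.** `stub_virginDiscShadowDecay → stub_virginization →
stub_boundaryCleanShadowDecay → EventualTight` (route `SAWExcursionCardy`, BY NAME): the atom
through the glue on interior shells and the boundary stub give `CleanMultiShadowDecay`; the landed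
equivalence `cleanMultiShadowDecay_iff_eventualTight` gives set-level tightness of the push-forward
laws on an initial mesh interval (the twin stmt-1372); the bridge
`isTightAlongMesh_of_isTightMeasureSet_image` gives tightness along the mesh filter. -/
theorem EventualTight_of (h1 : __Registered.stub_virginDiscShadowDecay)
    (h2 : __Registered.stub_virginization) (h3 : __Registered.stub_boundaryCleanShadowDecay) :
    Summit.CriticalPhenomena.SAWScalingLimit.Theses.SAWExcursionCardy.EventualTight := by
  -- interior shells from the atom through the exact glue, boundary shells from STUB 3
  have hclean : CleanMultiShadowDecay := cleanMultiShadowDecay_of_interior_of_boundary (h2 h1) h3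
  -- the landed equivalence with the set-form twin (route `SAWRenewalTightness`, stmt-1372)
  have hset : Summit.CriticalPhenomena.SAWScalingLimit.Theses.SAWRenewalTightness.EventualTight :=
    cleanMultiShadowDecay_iff_eventualTight.1 hclean
  -- set-level tightness on `(0, δ₀]` ⇒ tightness along `𝓝[>] 0`
  intro D a b hab
  obtain ⟨δ₀, hδ₀, hT⟩ := hset D a b hab
  exact isTightAlongMesh_of_isTightMeasureSet_image
    (Eventually.of_forall fun δ => SAW.aemeasurable_curve D.carrier δ (a δ) (b δ)) hδ₀ hT

/-- Wiring check: the registered stubs feed `EventualTight_of` as stated (becomes the crux proof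
when the three `sorry`s above are discharged). -/
example : Summit.CriticalPhenomena.SAWScalingLimit.Theses.SAWExcursionCardy.EventualTight :=
  EventualTight_of stub_virginDiscShadowDecay stub_virginization stub_boundaryCleanShadowDecay

end Summit.CriticalPhenomena.SAWScalingLimit.Cruxes.EventualTight.Birth

end
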